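import Literature.AlgebraicGeometry.Resolution.BlowupDisjointCentreSplitting
import Literature.AlgebraicGeometry.Resolution.BlowupOffCentre
import Literature.AlgebraicGeometry.Resolution.ReducedSubschemes
import HarnessLib

/-!
# Splitting a blowing up along a disconnected centre, II: the second centre under the first blowing up
# (stalks, orders, reduced / irreducible / regular pull-back, weights)

Topic: `Literature/AlgebraicGeometry/Resolution`. Companion of `BlowupDisjointCentreSplitting.lean` (res-type-002:
a blowing up `τ` along `P · Q` factors as `τ = τ₂ ≫ τ₁` through any blowing up `τ₁` along `P`, `τ₂` a blowing up
along `Q 𝒪_{E₁}`, Stacks 080A read backwards; the peeling of one piece off a regular centre). This file adds, for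
ideal sheaves `P`, `Q` with DISJOINT supports and a blowing up `τ₁ : E₁ → E′` along `P` (Görtz–Wedhorn I,
Prop. 13.91 (3) = Stacks 02OS: `τ₁` is an isomorphism over `E′ ∖ V(P) ⊇ V(Q)`), the transport statements AT THE
SECOND CENTRE that a WEIGHTED blow-up sequence consumes when a disconnected centre is blown up piece by piece
(Bierstone–Grigoriev–Milman–Włodarczyk 2011, §3.2 and §4 Step 2b):

* `IsBlowup.isBlowup_of_comp_eq` — ANY factor `τ₂` of `τ` through `τ₁` is a blowing up along `Q 𝒪_{E₁}`
  (`exists_fac_of_mul` + `fac_unique_of_mul` of the companion file);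
* `IdealSheafData.mul_eq_inf_of_disjoint` (`P · Q = P ⊓ Q`), `support_subset_centreCompl_of_disjoint`,
  `disjoint_support_comap_of_disjoint`, `not_mem_support_of_mem_of_disjoint`, `mem_support_comap_iff`;
* `IsBlowup.isIso_stalkMap_of_mem_support_of_disjoint`, `IsBlowup.idealOrder_comap_of_mem_support_of_disjoint` —
  at points over `V(Q)` the stalk maps of `τ₁` are isomorphisms and orders of pulled-back ideals are unchanged
  (BGMW Lemma 8.0.3); the stalk ideals there are the images under the stalk isomorphism (tree
  `stalkIdeal_comap_eq_map_stalkMap`);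
* `IsBlowup.image_support_comap_of_disjoint` — `τ₁` maps `V(Q 𝒪_{E₁})` ONTO `V(Q)`;
* `IsBlowup.comap_eq_vanishingIdeal_of_disjoint`, `IsBlowup.isIrreducible_support_comap_of_disjoint`,
  **`IsBlowup.isRegular_subscheme_comap_of_disjoint`** — a reduced / irreducible / regular second centre `V(Q)`
  pulls back to a reduced / irreducible / regular `V(Q 𝒪_{E₁})` (ideal-sheaf phrasing of the companion's
  `…_vanishingIdeal_preimage_of_disjoint` statements);
* `IsBlowup.stalkIdeal_comap_eq_top_of_mem_support_of_disjoint`,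
  `IsBlowup.stalkIdeal_controlledTransform_of_mem_support_of_disjoint`,
  **`IsBlowup.controlledTransform_le_pow_comap_of_disjoint`** — over `V(Q)` the exceptional ideal `P 𝒪_{E₁}` is the
  unit ideal, every controlled transform `τ₁ᶜ(𝔟, b)` is the total transform, and `𝔟 ⊆ Q^n` downstairs gives
  `τ₁ᶜ(𝔟, b) ⊆ (Q 𝒪_{E₁})^n` upstairs (the weight of the second piece survives the first blowing up);
* (the two-piece entry `V(C) = Z₁ ⊔ Z₂` — `isPiecePartition_pair`, `C = 𝓘(Z₁) · 𝓘(Z₂)`, regular pieces,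
  the summary factorisation — is rev 2 of the companion file and is not repeated here).

Everything is proved over the tree's carriers; no definitions. Written for the HIRONAKA-L lane of cell res-hironaka
(L W5.2, T5-E «W₂B-maxweight», res-D-pv-054's (P2)/(P5)) by res-D-pv-026.

## Sources

* The Stacks Project, Tag 080A, Tag 02OS, Tag 033B. [StacksProject]
* U. Görtz, T. Wedhorn, *Algebraic Geometry I* (2nd ed. 2020), Def. 13.90, Prop. 13.91 (3) p. 414. [GortzWedhorn2020]
* E. Bierstone, D. Grigoriev, P. Milman, J. Włodarczyk, arXiv:1206.3090, §3.2 (controlled transform), Lemma 8.0.3,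
  Thm. 8.0.5, §4 Step 2b (p. 12–13). [BierstoneGrigorievMilmanWlodarczyk2011]
-/

noncomputable section

open CategoryTheory CategoryTheory.Limits AlgebraicGeometry TopologicalSpace IsLocalRing

namespace Literature.AlgebraicGeometry.Resolution

universe u

open Scheme.IdealSheafData

/-! ## Any factor through the first blowing up is a blowing up along the pulled-back second centre -/

section Factor

variable {E'' E₁ E' : Scheme.{u}} {τ : E'' ⟶ E'} {τ₁ : E₁ ⟶ E'} {P Q : E'.IdealSheafData}

/-- **Any factor `τ₂` of a blowing up `τ` along `P · Q` through a blowing up `τ₁` along `P` is a blowing up along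
`Q 𝒪_{E₁}`** (the factor exists and is unique: `IsBlowup.exists_fac_of_mul`, `IsBlowup.fac_unique_of_mul`).
[cite: StacksProject, Tag 080A] -/
theorem IsBlowup.isBlowup_of_comp_eq (hτ : IsBlowup τ (P * Q)) (hτ₁ : IsBlowup τ₁ P) {τ₂ : E'' ⟶ E₁}
    (h : τ₂ ≫ τ₁ = τ) : IsBlowup τ₂ (Q.comap τ₁) := by
  obtain ⟨τ₂', hτ₂', h'⟩ := hτ.exists_fac_of_mul hτ₁
  rw [hτ.fac_unique_of_mul hτ₁ h h']
  exact hτ₂'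

/-- The exceptional ideal of the composite: `(P · Q) 𝒪_{E″} = τ₂*(P 𝒪_{E₁}) · τ₂*(Q 𝒪_{E₁})` when `τ₂ ≫ τ₁ = τ`
(Stacks 080A: «the effective Cartier divisor `E″ = E′ + (b′)⁻¹E`»). [cite: StacksProject, Tag 080A] -/
theorem IsBlowup.comap_mul_eq_of_fac {τ₂ : E'' ⟶ E₁} (h : τ₂ ≫ τ₁ = τ) :
    (P * Q).comap τ = (P.comap τ₁).comap τ₂ * (Q.comap τ₁).comap τ₂ := by
  rw [← h, comap_mul, comap_comp, comap_comp]

end Factor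

/-! ## Disjoint centres: the first blowing up is an isomorphism near the second centre -/

section Disjoint

variable {E₁ E' : Scheme.{u}} {τ₁ : E₁ ⟶ E'} {P Q : E'.IdealSheafData}

/-- Ideal sheaves with disjoint supports multiply to their intersection: `P · Q = P ∩ Q` (they are comaximal; the
pieces of a split centre multiply back to the centre, BGMW §4 Step 2). [cite: BierstoneGrigorievMilmanWlodarczyk2011, §4 Step 2 (p. 12)] -/
theorem IdealSheafData.mul_eq_inf_of_disjoint (hd : Disjoint (P.support : Set E') (Q.support : Set E')) :
    P * Q = P ⊓ Q :=
  IdealSheafData.mul_eq_inf_of_sup_eq_top (IdealSheafData.sup_eq_top_of_disjoint_support hd)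

/-- `V(Q)` lies in the open complement of `V(P)` — over which a blowing up along `P` is an isomorphism
(tree `IsBlowup.isIso_compl`). [cite: GortzWedhorn2020, Prop. 13.91 (3) p. 414] -/
theorem support_subset_centreCompl_of_disjoint (hd : Disjoint (P.support : Set E') (Q.support : Set E')) :
    (Q.support : Set E') ⊆ (centreCompl P : Set E') :=
  fun _ hx hP => hd.le_bot ⟨hP, hx⟩

/-- The pulled-back centres stay disjoint: `V(P 𝒪_{E₁}) ∩ V(Q 𝒪_{E₁}) = ∅` (tree `disjoint_support_comap` of
`ReducedSubschemes.lean`, which only asks disjointness over the image). [cite: BierstoneGrigorievMilmanWlodarczyk2011, §4 Step 2 (p. 12)] -/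
theorem disjoint_support_comap_of_disjoint (hd : Disjoint (P.support : Set E') (Q.support : Set E'))
    (f : E₁ ⟶ E') : Disjoint ((P.comap f).support : Set E₁) ((Q.comap f).support : Set E₁) :=
  disjoint_support_comap f (hd.mono Set.inter_subset_left Set.inter_subset_left)

/-- A point over `V(Q)` is off `V(P)`. [cite: BierstoneGrigorievMilmanWlodarczyk2011, §4 Step 2 (p. 12)] -/
theorem not_mem_support_of_mem_of_disjoint (hd : Disjoint (P.support : Set E') (Q.support : Set E')) {y : E₁}
    (hy : τ₁ y ∈ (Q.support : Set E')) : τ₁ y ∉ (P.support : Set E') :=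
  fun h => hd.le_bot ⟨h, hy⟩

/-- The points of `V(Q 𝒪_{E₁})` are the points over `V(Q)` (`V(Q 𝒪_{E₁}) = τ₁⁻¹ V(Q)`). [cite: BierstoneGrigorievMilmanWlodarczyk2011, §4 Step 2 (p. 12)] -/
theorem mem_support_comap_iff (f : E₁ ⟶ E') (K : E'.IdealSheafData) (y : E₁) :
    y ∈ ((K.comap f).support : Set E₁) ↔ f y ∈ (K.support : Set E') := by
  rw [support_comap, Closeds.coe_preimage, Set.mem_preimage]

/-- **At points over `V(Q)` the stalk maps of a blowing up along `P` are isomorphisms** (`V(Q)` misses the centre).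
[cite: GortzWedhorn2020, Prop. 13.91 (3) p. 414] -/
theorem IsBlowup.isIso_stalkMap_of_mem_support_of_disjoint (hτ₁ : IsBlowup τ₁ P)
    (hd : Disjoint (P.support : Set E') (Q.support : Set E')) {y : E₁} (hy : τ₁ y ∈ (Q.support : Set E')) :
    IsIso (τ₁.stalkMap y) :=
  hτ₁.isIso_stalkMap_of_not_mem_support (not_mem_support_of_mem_of_disjoint hd hy)

/-- **At points over `V(Q)` a blowing up along `P` does not change orders**: `ord_y(J 𝒪_{E₁}) = ord_{τ₁ y}(J)` for
every ideal sheaf `J` on `E′`. [cite: BierstoneGrigorievMilmanWlodarczyk2011, Lemma 8.0.3 (2)] -/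
theorem IsBlowup.idealOrder_comap_of_mem_support_of_disjoint (hτ₁ : IsBlowup τ₁ P)
    (hd : Disjoint (P.support : Set E') (Q.support : Set E')) (J : E'.IdealSheafData) {y : E₁}
    (hy : τ₁ y ∈ (Q.support : Set E')) : idealOrder (J.comap τ₁) y = idealOrder J (τ₁ y) :=
  hτ₁.idealOrder_comap_of_not_mem J (not_mem_support_of_mem_of_disjoint hd hy)

/-- **`τ₁` maps `V(Q 𝒪_{E₁})` ONTO `V(Q)`**: every point of `V(Q)` has a preimage (the blowing up is an isomorphism,
in particular surjective, over `E′ ∖ V(P) ⊇ V(Q)`). [cite: GortzWedhorn2020, Prop. 13.91 (3) p. 414] -/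
theorem IsBlowup.image_support_comap_of_disjoint (hτ₁ : IsBlowup τ₁ P)
    (hd : Disjoint (P.support : Set E') (Q.support : Set E')) :
    τ₁ '' ((Q.comap τ₁).support : Set E₁) = (Q.support : Set E') := by
  apply le_antisymm
  · rintro _ ⟨y, hy, rfl⟩
    exact (mem_support_comap_iff τ₁ Q y).mp hy
  · intro z hz
    have hzC : z ∈ (centreCompl P : Set E') := support_subset_centreCompl_of_disjoint hd hz
    haveI : IsIso (τ₁ ∣_ centreCompl P) := hτ₁.isIso_compl
    obtain ⟨w, hw⟩ := (τ₁ ∣_ centreCompl P).homeomorph.surjective ⟨z, hzC⟩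
    have hw' : τ₁ w.1 = z := by
      have := congrArg Subtype.val hw
      simpa [morphismRestrict_base_coe] using this
    refine ⟨w.1, ?_, hw'⟩
    rw [mem_support_comap_iff, hw']
    exact hz

/-- **A reduced second centre pulls back to the reduced ideal of its preimage**: if `Q = 𝓘(V(Q))` (e.g. `V(Q)` is a
regular, or just reduced, closed subscheme) and `V(Q)` misses `V(P)`, then `Q 𝒪_{E₁} = 𝓘(τ₁⁻¹ V(Q))` (`E′` locally
Noetherian). [cite: StacksProject, Tag 033B] -/
theorem IsBlowup.comap_eq_vanishingIdeal_of_disjoint [IsLocallyNoetherian E'] (hτ₁ : IsBlowup τ₁ P)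
    (hd : Disjoint (P.support : Set E') (Q.support : Set E')) (hQ : Q = vanishingIdeal Q.support) :
    Q.comap τ₁ = vanishingIdeal (Q.comap τ₁).support := by
  have h := hτ₁.comap_vanishingIdeal_of_disjoint Q.support hd.symm
  conv_rhs => rw [support_comap, ← h, ← hQ]

/-- **`V(Q 𝒪_{E₁})` is irreducible if `V(Q)` is** (and misses `V(P)`). [cite: GortzWedhorn2020, Prop. 13.91 (3) p. 414] -/
theorem IsBlowup.isIrreducible_support_comap_of_disjoint (hτ₁ : IsBlowup τ₁ P)
    (hd : Disjoint (P.support : Set E') (Q.support : Set E')) (hirr : IsIrreducible (Q.support : Set E')) :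
    IsIrreducible ((Q.comap τ₁).support : Set E₁) := by
  rw [support_comap, Closeds.coe_preimage]
  exact hτ₁.isIrreducible_preimage_of_disjoint Q.support hd.symm hirr

/-- **`V(Q 𝒪_{E₁})` is a regular scheme if `V(Q)` is** (and misses `V(P)`; `E′` locally Noetherian): a regular closed
subscheme is reduced, so `Q = 𝓘(V(Q))` and `Q 𝒪_{E₁} = 𝓘(τ₁⁻¹V(Q))`, the reduced structure on the preimage, which is
regular because `τ₁` is an isomorphism over `E′ ∖ V(P)` (BGMW Thm. 8.0.5: regular centres pull back along étale
morphisms; tree `IsBlowup.isRegular_subscheme_vanishingIdeal_preimage`).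
[cite: BierstoneGrigorievMilmanWlodarczyk2011, Thm. 8.0.5 with Def. 3.1.3] -/
theorem IsBlowup.isRegular_subscheme_comap_of_disjoint [IsLocallyNoetherian E'] (hτ₁ : IsBlowup τ₁ P)
    (hd : Disjoint (P.support : Set E') (Q.support : Set E')) (hQ : Scheme.IsRegular Q.subscheme) :
    Scheme.IsRegular (Q.comap τ₁).subscheme := by
  have hQeq : Q = vanishingIdeal Q.support := eq_vanishingIdeal_support_of_isRegular Q hQ
  have hreg := hτ₁.isRegular_subscheme_vanishingIdeal_preimage Q.support hd.symm (by rw [← hQeq]; exact hQ)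
  rw [← hτ₁.comap_vanishingIdeal_of_disjoint Q.support hd.symm, ← hQeq] at hreg
  exact hreg

/-! ### Weights: the exceptional factor of `τ₁` is a unit near the second centre -/

/-- **At points over `V(Q)` the exceptional ideal `P 𝒪_{E₁}` of `τ₁` is the unit ideal.**
[cite: GortzWedhorn2020, Prop. 13.91 (3) p. 414] -/
theorem IsBlowup.stalkIdeal_comap_eq_top_of_mem_support_of_disjoint (hτ₁ : IsBlowup τ₁ P)
    (hd : Disjoint (P.support : Set E') (Q.support : Set E')) {y : E₁} (hy : τ₁ y ∈ (Q.support : Set E')) :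
    stalkIdeal (P.comap τ₁) y = ⊤ :=
  hτ₁.stalkIdeal_comap_centre_eq_top (not_mem_support_of_mem_of_disjoint hd hy)

/-- **At points over `V(Q)` every controlled transform along `τ₁` is the total transform**:
`(τ₁ᶜ(𝔟, b))_y = (𝔟 𝒪_{E₁})_y`. [cite: BierstoneGrigorievMilmanWlodarczyk2011, §3.2] -/
theorem IsBlowup.stalkIdeal_controlledTransform_of_mem_support_of_disjoint (hτ₁ : IsBlowup τ₁ P)
    (hd : Disjoint (P.support : Set E') (Q.support : Set E')) (𝔟 : E'.IdealSheafData) (b : ℕ) {y : E₁}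
    (hy : τ₁ y ∈ (Q.support : Set E')) :
    stalkIdeal (controlledTransform τ₁ P 𝔟 b) y = stalkIdeal (𝔟.comap τ₁) y :=
  hτ₁.stalkIdeal_controlledTransform_of_not_mem 𝔟 b (not_mem_support_of_mem_of_disjoint hd hy)

/-- **The weight of the second piece survives the first blowing up**: if `𝔟 ⊆ Q^n` on `E′` and `V(P) ∩ V(Q) = ∅`,
then for every `b` the controlled transform `τ₁ᶜ(𝔟, b) = (𝔟 𝒪_{E₁} : (P 𝒪_{E₁})^b)` lies in `(Q 𝒪_{E₁})^n` — at
points over `V(Q)` it is the total transform `𝔟 𝒪_{E₁} ⊆ (Q^n) 𝒪_{E₁}`, elsewhere `(Q 𝒪_{E₁})^n` is the unit ideal.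
(The permissibility clause `𝔟_{j+1} ≤ C_{j+1}^{ν}` of a weighted blow-up sequence for the lifted second piece; the
total-transform version `𝔟 𝒪_{E₁} ⊆ (Q 𝒪_{E₁})^n` is the tree's `comap_le_comap_pow_of_le_pow`.)
[cite: BierstoneGrigorievMilmanWlodarczyk2011, §3.2 with Lemma 3.2.1 (2)] -/
theorem IsBlowup.controlledTransform_le_pow_comap_of_disjoint (hτ₁ : IsBlowup τ₁ P)
    (hd : Disjoint (P.support : Set E') (Q.support : Set E')) {𝔟 : E'.IdealSheafData} {n : ℕ} (b : ℕ)
    (h : 𝔟 ≤ Q ^ n) : controlledTransform τ₁ P 𝔟 b ≤ Q.comap τ₁ ^ n := by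
  refine le_of_forall_stalkIdeal_le fun y => ?_
  by_cases hy : τ₁ y ∈ (Q.support : Set E')
  · rw [hτ₁.stalkIdeal_controlledTransform_of_mem_support_of_disjoint hd 𝔟 b hy]
    exact stalkIdeal_mono (comap_le_comap_pow_of_le_pow h τ₁) y
  · have hy' : y ∉ (Q.comap τ₁).support := fun h' => hy ((mem_support_comap_iff τ₁ Q y).mp h')
    rw [stalkIdeal_pow, stalkIdeal_eq_top_of_not_mem_support hy', Ideal.top_pow]
    exact le_top

end Disjoint

end Literature.AlgebraicGeometry.Resolution

end
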